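/-
Copyright (c) 2026 the pub-hodgecm-mathlib formalisation cell (harness21).  Prover seat hodgecm-mathlib-F0P3a-p01 (g36), FLOOR 0, SUPPORTS-ONLY on h413; dealer LH4-plan (g13)
WORD #74 (1): owner of (T-box | lev) (b)+(c).  FILE 2 «LEV TILING».  2026-09-04.
-/
import Summits.HodgeConjecture.HodgeConjecture.Theorems.F0P3cDyRamKappaCountBoxSumTiling   -- ★ p14 FILE 3: `leaf_T`, `leaf_Z`, `leaf_TT`
import Summits.HodgeConjecture.HodgeConjecture.Theorems.F0P3cDyRamLevBoxSumArith         -- FILE 2a (this seat): the pure-ℕ letters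
import Summits.HodgeConjecture.HodgeConjecture.Theorems.F0P3cDyRamLevBoxSumTilingApexOne
import Summits.HodgeConjecture.HodgeConjecture.Theorems.F0P3cDyRamLevBoxSumTilingApexTwo
import Summits.HodgeConjecture.HodgeConjecture.Theorems.F0P3cDyRamLevBoxSumTilingEqui
import HarnessLib

/-!
# Crux `H413`, LH4 «(D-RAM) FOUR-FRAME» road, STAGE 1b — brick (T-box | lev) FILE 2f «LEV TILING, dispatch»: the exponent bookkeeping of the general two-parameter law (L-gen)

Cell `hodgecm-mathlib` (D-0151), crux item H413 = `stmt-HodgeConjecture-24833`, route of record `HCCMUnconditional`.  THEOREMS ONLY (pure `ℕ`∕`ℚ` bookkeeping; no lattices,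
no `def`, no instance, no notation, no `sorry`, default heartbeats); lane `--supports stmt-HodgeConjecture-24833 --as helper` (count-neutral).  Twin of ★ `kappa_arith`
(LH4-p14 (g3), `ℓ₁ = ℓ₂ = 0`) and ★ `kappa_arith_trunc` (LH4-p10 (g6), the row `(0, mstarOfRecord d)`), for the tables of ★ p860066∕p860094 `LevLabelledBoxSum(Wide) ℓ₁ ℓ₂`.

THE MATHEMATICS (memo `F0/P3a/F0P3a-p01/g36/tbox/TBOX-LEV-SPEC.v1.F0P3ap01g36.md` 7f362386 §4; closed forms certified by `tbox/evalcheck.py`, 50 148 ∕ 50 148).  After FILE 1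
(`kappa_plane_sum_lev`, `kappa_diag_sum_lev`) and ★ `foot_mul_eval` ∕ ★ `window_mul_eval'`, `(x − 1)·Σ_{box}` of the two-token κ-table is a sum of evaluated blocks:
per apex plane the FOOT block `[⌊N∕2⌋ + d ≤ ⌊(n−ℓ₁)∕2⌋]·ω·(x^{⌊(n−ℓ₁)∕2⌋+⌊N∕2⌋+1} − x^{2⌊N∕2⌋+d})`, `N = min(min(n′,n″), n_r − ℓ₁, 2n_r − ℓ₂)`, and the LOCUS window
`εG·[max(1,L) ≤ C]·(x^{A+C+1} − x^{A+max(1,L)})`, `A = 2⌊(n′−ℓ₁)∕2⌋ + s∕2`, `L = d − s∕2 ∣ d`, `C = min(n′−ℓ₁−M, ⌊(2n′−ℓ₂)∕2⌋−M, ⌊(2n′−d+1−ℓ₁)∕2⌋−M)`,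
`M = ⌊(n′−ℓ₁)∕2⌋`; plus the H window on an equilateral key.  THE IDENTITY: their total is `SIGN·(x^{k−X} − x^{k−max(X, B+y)})`, `2k + d = Σn + 2`,
`2B = (n_i + 2(d%2) + 2 − 3d)⁺`, `y = 2⌈(ℓ₁ − d%2)∕2⌉`, `X = max(ℓ₁, (⌊(ℓ₂+1)∕2⌋ − ⌊d∕2⌋)⁺ + y∕2)`: the `D₂` level truncates the TOP of ★ `kappa_arith`'s tiling
`[k−B, k−1]`, the `D₁` level truncates the top at `k − ℓ₁` and, per foot-parity step, OPENS TWO LAYERS BELOW the unit's bottom.  Rows of record: lo `(cs, 0)`,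
hi `(cs+1, 2)`, clean-lo `(sT, 0)`, clean-hi `(sT+1, 2)`.  MECHANISM of the proof: parities made explicit (`d = 2e+δ`, `n = 2a+δ`, …), slots by `fin_cases`, the
conductor side condition `εG p p = ω` when the apex excess is `≥ 2d`, every leaf an exponent identity closed by `omega` (which digests `min`, `max`, `∕2`).
* `kappa_arith_lev_apex0`, `kappa_arith_lev_apex1`, `kappa_arith_lev_apex2` (strictly isoceles keys), `kappa_arith_lev_equi` (equilateral), and the dispatch
  **`kappa_arith_lev`** — HEAD, hypotheses = ★ p860094 `LevLabelledBoxSumWide`'s arithmetic ones.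

HONEST LABEL: arithmetic helper toward `levLabelledBoxSumWide_holds` (FILE 3); pays no tier-0 row; the four (L-lev) law stubs and their `hTrunk` binders stay OPEN; HC_CM is
proved only modulo the 7 printed citations (2 remaining named inputs: hLiu418 = `stmt-HodgeConjecture-24832`, h413 = `stmt-HodgeConjecture-24833`) until rung 0 closes.

## References
* [Kottwitz1986BaseChangeUnits] R. E. Kottwitz, *Base change for unit elements of Hecke algebras*, Compositio Math. 60 (1986), §1 pp. 240–241.
* [Rogawski1990] J. D. Rogawski, *Automorphic Representations of Unitary Groups in Three Variables*, Ann. of Math. Stud. 123 (1990), §4.9 Prop. 4.9.1 (a) p. 55; §4.10 p. 58.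
-/

set_option autoImplicit false

namespace Summit.HodgeConjecture.HodgeConjecture.Cruxes.H413.F0P3cDyRamLevBoxSumTilingDispatch

open Finset
open Summit.HodgeConjecture.HodgeConjecture.Cruxes.H413.F0P3cDyRamKappaCountBoxSumTiling (leaf_T leaf_Z leaf_TT)
open Summit.HodgeConjecture.HodgeConjecture.Cruxes.H413.F0P3cDyRamLevBoxSumArith
open Summit.HodgeConjecture.HodgeConjecture.Cruxes.H413.F0P3cDyRamLevBoxSumTiling
open Summit.HodgeConjecture.HodgeConjecture.Cruxes.H413.F0P3cDyRamLevBoxSumTilingApexOne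
open Summit.HodgeConjecture.HodgeConjecture.Cruxes.H413.F0P3cDyRamLevBoxSumTilingApexTwo
open Summit.HodgeConjecture.HodgeConjecture.Cruxes.H413.F0P3cDyRamLevBoxSumTilingEqui


/-- **THE LEV TILING** for an isoceles key under ★ p860094 `LevLabelledBoxSumWide`'s arithmetic hypotheses (fence `2d ≤ nⱼ + 1`, `ℓ₁ ≤ 2`, wide `ℓ₂ ≤ nⱼ + ℓ₁`,
the corner): the evaluated blocks of the TWO-TOKEN κ-table — foot blocks at the shifted `(⌊(n−ℓ₁)∕2⌋, ⌊N∕2⌋)` (★ `foot_mul_eval` after FILE 1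
`kappa_plane_sum_lev`), locus ∕ H windows shifted and clipped (FILE 1, ★ `window_mul_eval`) — total `SIGN·(x^(k−X) − x^(k − max X (B+y)))`,
`X = max ℓ₁ ((ℓ₂+1)∕2 − d∕2 + (ℓ₁+1−d%2)∕2)`, `y = 2((ℓ₁+1−d%2)∕2)`: the general two-parameter law (L-gen) (memo TBOX-LEV-SPEC §4); dispatch on the
orientation and the slot. ★ `kappa_arith` is the row `ℓ₁ = ℓ₂ = 0`, ★ `kappa_arith_trunc` (LH4-p10 (g6)) the row `(0, mstarOfRecord d)`. [folklore] -/
theorem kappa_arith_lev (x ω εH : ℚ) (εG : Fin 3 → Fin 3 → ℚ) {d n₁ n₂ n₃ k ℓ₁ ℓ₂ : ℕ} (hd : 2 ≤ d)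
    (hiso : (n₁ = n₂ ∧ n₁ ≤ n₃) ∨ (n₁ = n₃ ∧ n₁ ≤ n₂) ∨ (n₂ = n₃ ∧ n₂ ≤ n₁))
    (h1 : n₁ % 2 = d % 2) (h2 : n₂ % 2 = d % 2) (h3 : n₃ % 2 = d % 2)
    (hk : 2 * k + d = n₁ + n₂ + n₃ + 2) (hf1 : 2 * d ≤ n₁ + 1) (hf2 : 2 * d ≤ n₂ + 1) (hf3 : 2 * d ≤ n₃ + 1)
    (hℓ₁ : ℓ₁ ≤ 2) (hℓ₂ : ℓ₂ ≤ n₁ + ℓ₁ ∧ ℓ₂ ≤ n₂ + ℓ₁ ∧ ℓ₂ ≤ n₃ + ℓ₁) (hcorner : d % 2 = 0 → ℓ₁ = 1 → d + 1 ≤ ℓ₂) (i : Fin 3)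
    (hω0 : i = 0 → n₂ = n₃ → n₂ + 2 * d ≤ n₁ → εG 0 0 = ω) (hω1 : i = 1 → n₁ = n₃ → n₁ + 2 * d ≤ n₂ → εG 1 1 = ω)
    (hω2 : i = 2 → n₁ = n₂ → n₁ + 2 * d ≤ n₃ → εG 2 2 = ω) :
    (if n₁ = n₂ ∧ n₂ = n₃ then εH * (if max 1 d ≤ min (n₁ - ℓ₁ - (n₁ - ℓ₁) / 2) (min ((2 * n₁ - ℓ₂) / 2 - (n₁ - ℓ₁) / 2) ((2 * n₁ - d + 1 - ℓ₁) / 2 - (n₁ - ℓ₁) / 2)) then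
          x ^ (2 * ((n₁ - ℓ₁) / 2) + min (n₁ - ℓ₁ - (n₁ - ℓ₁) / 2) (min ((2 * n₁ - ℓ₂) / 2 - (n₁ - ℓ₁) / 2) ((2 * n₁ - d + 1 - ℓ₁) / 2 - (n₁ - ℓ₁) / 2)) + 1) - x ^ (2 * ((n₁ - ℓ₁) / 2) + max 1 d) else 0) else 0) +
        ((if i = 0 then (if min (min n₂ n₃) (min (n₂ - ℓ₁) (2 * n₂ - ℓ₂)) / 2 + d ≤ (n₁ - ℓ₁) / 2 then
            ω * (x ^ ((n₁ - ℓ₁) / 2 + min (min n₂ n₃) (min (n₂ - ℓ₁) (2 * n₂ - ℓ₂)) / 2 + 1) - x ^ (2 * (min (min n₂ n₃) (min (n₂ - ℓ₁) (2 * n₂ - ℓ₂)) / 2) + d)) else 0) else 0) +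
          (if n₂ = n₃ ∧ n₂ < n₁ ∧ (n₁ - n₂) % 2 = 0 then εG 0 i *
            (if max 1 (if i = 0 then d - (n₁ - n₂) / 2 else d) ≤ min (n₂ - ℓ₁ - (n₂ - ℓ₁) / 2) (min ((2 * n₂ - ℓ₂) / 2 - (n₂ - ℓ₁) / 2) ((2 * n₂ - d + 1 - ℓ₁) / 2 - (n₂ - ℓ₁) / 2)) then
              x ^ (2 * ((n₂ - ℓ₁) / 2) + (n₁ - n₂) / 2 + min (n₂ - ℓ₁ - (n₂ - ℓ₁) / 2) (min ((2 * n₂ - ℓ₂) / 2 - (n₂ - ℓ₁) / 2) ((2 * n₂ - d + 1 - ℓ₁) / 2 - (n₂ - ℓ₁) / 2)) + 1) -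
                x ^ (2 * ((n₂ - ℓ₁) / 2) + (n₁ - n₂) / 2 + max 1 (if i = 0 then d - (n₁ - n₂) / 2 else d)) else 0) else 0)) +
        ((if i = 1 then (if min (min n₁ n₃) (min (n₁ - ℓ₁) (2 * n₁ - ℓ₂)) / 2 + d ≤ (n₂ - ℓ₁) / 2 then
            ω * (x ^ ((n₂ - ℓ₁) / 2 + min (min n₁ n₃) (min (n₁ - ℓ₁) (2 * n₁ - ℓ₂)) / 2 + 1) - x ^ (2 * (min (min n₁ n₃) (min (n₁ - ℓ₁) (2 * n₁ - ℓ₂)) / 2) + d)) else 0) else 0) +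
          (if n₁ = n₃ ∧ n₁ < n₂ ∧ (n₂ - n₁) % 2 = 0 then εG 1 i *
            (if max 1 (if i = 1 then d - (n₂ - n₁) / 2 else d) ≤ min (n₁ - ℓ₁ - (n₁ - ℓ₁) / 2) (min ((2 * n₁ - ℓ₂) / 2 - (n₁ - ℓ₁) / 2) ((2 * n₁ - d + 1 - ℓ₁) / 2 - (n₁ - ℓ₁) / 2)) then
              x ^ (2 * ((n₁ - ℓ₁) / 2) + (n₂ - n₁) / 2 + min (n₁ - ℓ₁ - (n₁ - ℓ₁) / 2) (min ((2 * n₁ - ℓ₂) / 2 - (n₁ - ℓ₁) / 2) ((2 * n₁ - d + 1 - ℓ₁) / 2 - (n₁ - ℓ₁) / 2)) + 1) -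
                x ^ (2 * ((n₁ - ℓ₁) / 2) + (n₂ - n₁) / 2 + max 1 (if i = 1 then d - (n₂ - n₁) / 2 else d)) else 0) else 0)) +
        ((if i = 2 then (if min (min n₁ n₂) (min (n₂ - ℓ₁) (2 * n₂ - ℓ₂)) / 2 + d ≤ (n₃ - ℓ₁) / 2 then
            ω * (x ^ ((n₃ - ℓ₁) / 2 + min (min n₁ n₂) (min (n₂ - ℓ₁) (2 * n₂ - ℓ₂)) / 2 + 1) - x ^ (2 * (min (min n₁ n₂) (min (n₂ - ℓ₁) (2 * n₂ - ℓ₂)) / 2) + d)) else 0) else 0) +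
          (if n₁ = n₂ ∧ n₁ < n₃ ∧ (n₃ - n₁) % 2 = 0 then εG 2 i *
            (if max 1 (if i = 2 then d - (n₃ - n₁) / 2 else d) ≤ min (n₁ - ℓ₁ - (n₁ - ℓ₁) / 2) (min ((2 * n₁ - ℓ₂) / 2 - (n₁ - ℓ₁) / 2) ((2 * n₁ - d + 1 - ℓ₁) / 2 - (n₁ - ℓ₁) / 2)) then
              x ^ (2 * ((n₁ - ℓ₁) / 2) + (n₃ - n₁) / 2 + min (n₁ - ℓ₁ - (n₁ - ℓ₁) / 2) (min ((2 * n₁ - ℓ₂) / 2 - (n₁ - ℓ₁) / 2) ((2 * n₁ - d + 1 - ℓ₁) / 2 - (n₁ - ℓ₁) / 2)) + 1) -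
                x ^ (2 * ((n₁ - ℓ₁) / 2) + (n₃ - n₁) / 2 + max 1 (if i = 2 then d - (n₃ - n₁) / 2 else d)) else 0) else 0))
      = (if n₁ = n₂ ∧ n₂ = n₃ then εH else if n₂ = n₃ then εG 0 i else if n₁ = n₃ then εG 1 i else εG 2 i) *
        (x ^ (k - max ℓ₁ ((ℓ₂ + 1) / 2 - d / 2 + (ℓ₁ + 1 - d % 2) / 2)) -
          x ^ (k - max (max ℓ₁ ((ℓ₂ + 1) / 2 - d / 2 + (ℓ₁ + 1 - d % 2) / 2))
            ((((![n₁, n₂, n₃] : Fin 3 → ℕ) i + 2 * (d % 2) + 2 - 3 * d) / 2) + 2 * ((ℓ₁ + 1 - d % 2) / 2)))) := by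
  rcases hiso with ⟨h12, h13⟩ | ⟨h13, h12⟩ | ⟨h23, h21⟩
  · subst h12
    rcases Nat.lt_or_ge n₁ n₃ with hlt | hge
    · obtain rfl | rfl | rfl : i = 0 ∨ i = 1 ∨ i = 2 := by fin_cases i <;> simp
      · exact kappa_arith_lev_apex2_slot0 x ω εH εG hd hlt h1 h3 hk hf1 hf3 hℓ₁ hℓ₂.1 hcorner 0 rfl
      · exact kappa_arith_lev_apex2_slot1 x ω εH εG hd hlt h1 h3 hk hf1 hf3 hℓ₁ hℓ₂.1 hcorner 1 rfl
      · exact kappa_arith_lev_apex2_slot2 x ω εH εG hd hlt h1 h3 hk hf1 hf3 hℓ₁ hℓ₂.1 hcorner 2 rfl (fun h => hω2 rfl rfl h)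
    · have h : n₁ = n₃ := le_antisymm h13 hge
      subst h
      obtain rfl | rfl | rfl : i = 0 ∨ i = 1 ∨ i = 2 := by fin_cases i <;> simp
      · exact kappa_arith_lev_equi_slot0 x ω εH εG hd h1 hk hf1 hℓ₁ hℓ₂.1 hcorner 0 rfl
      · exact kappa_arith_lev_equi_slot1 x ω εH εG hd h1 hk hf1 hℓ₁ hℓ₂.1 hcorner 1 rfl
      · exact kappa_arith_lev_equi_slot2 x ω εH εG hd h1 hk hf1 hℓ₁ hℓ₂.1 hcorner 2 rfl
  · subst h13
    rcases Nat.lt_or_ge n₁ n₂ with hlt | hge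
    · obtain rfl | rfl | rfl : i = 0 ∨ i = 1 ∨ i = 2 := by fin_cases i <;> simp
      · exact kappa_arith_lev_apex1_slot0 x ω εH εG hd hlt h1 h2 hk hf1 hf2 hℓ₁ hℓ₂.1 hcorner 0 rfl
      · exact kappa_arith_lev_apex1_slot1 x ω εH εG hd hlt h1 h2 hk hf1 hf2 hℓ₁ hℓ₂.1 hcorner 1 rfl (fun h => hω1 rfl rfl h)
      · exact kappa_arith_lev_apex1_slot2 x ω εH εG hd hlt h1 h2 hk hf1 hf2 hℓ₁ hℓ₂.1 hcorner 2 rfl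
    · have h : n₁ = n₂ := le_antisymm h12 hge
      subst h
      obtain rfl | rfl | rfl : i = 0 ∨ i = 1 ∨ i = 2 := by fin_cases i <;> simp
      · exact kappa_arith_lev_equi_slot0 x ω εH εG hd h1 hk hf1 hℓ₁ hℓ₂.1 hcorner 0 rfl
      · exact kappa_arith_lev_equi_slot1 x ω εH εG hd h1 hk hf1 hℓ₁ hℓ₂.1 hcorner 1 rfl
      · exact kappa_arith_lev_equi_slot2 x ω εH εG hd h1 hk hf1 hℓ₁ hℓ₂.1 hcorner 2 rfl
  · subst h23
    rcases Nat.lt_or_ge n₂ n₁ with hlt | hge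
    · obtain rfl | rfl | rfl : i = 0 ∨ i = 1 ∨ i = 2 := by fin_cases i <;> simp
      · exact kappa_arith_lev_apex0_slot0 x ω εH εG hd hlt h2 h1 hk hf2 hf1 hℓ₁ hℓ₂.2.1 hcorner 0 rfl (fun h => hω0 rfl rfl h)
      · exact kappa_arith_lev_apex0_slot1 x ω εH εG hd hlt h2 h1 hk hf2 hf1 hℓ₁ hℓ₂.2.1 hcorner 1 rfl
      · exact kappa_arith_lev_apex0_slot2 x ω εH εG hd hlt h2 h1 hk hf2 hf1 hℓ₁ hℓ₂.2.1 hcorner 2 rfl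
    · have h : n₂ = n₁ := le_antisymm h21 hge
      subst h
      obtain rfl | rfl | rfl : i = 0 ∨ i = 1 ∨ i = 2 := by fin_cases i <;> simp
      · exact kappa_arith_lev_equi_slot0 x ω εH εG hd h2 hk hf2 hℓ₁ hℓ₂.2.1 hcorner 0 rfl
      · exact kappa_arith_lev_equi_slot1 x ω εH εG hd h2 hk hf2 hℓ₁ hℓ₂.2.1 hcorner 1 rfl
      · exact kappa_arith_lev_equi_slot2 x ω εH εG hd h2 hk hf2 hℓ₁ hℓ₂.2.1 hcorner 2 rfl

end Summit.HodgeConjecture.HodgeConjecture.Cruxes.H413.F0P3cDyRamLevBoxSumTilingDispatch
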